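import Literature.AlgebraicGeometry.Resolution.RegularCentreBlowupSeqIntegral
import Literature.AlgebraicGeometry.Resolution.NonPrincipalLocus
import Literature.AlgebraicGeometry.Resolution.NormalCrossingsLocal
import Literature.AlgebraicGeometry.Resolution.BlowupSequences
import Literature.AlgebraicGeometry.Resolution.AlterationsBlowupDivisorProofs
import Literature.AlgebraicGeometry.Resolution.QuasiProjectiveResolution
import HarnessLib

/-!
# Extending a sequence of blowing ups along regular centres from an open subscheme

Topic: `Literature/AlgebraicGeometry/Resolution`. When principalization of ideal sheaves
(`CossartPiltant2019Principalization`, Cossart–Piltant 2019 Prop. 4.4 = arXiv v1 Prop. 4.3: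
stated for a REGULAR excellent threefold `𝒮`) is applied to the regular locus `U = Reg(X)` of a
singular projective threefold `X` — as in every use of "Axiom 4" in Zariski–Piltant patching
(Piltant 2013, §2 Axiom 4 and Prop. 5.1, Steps 2, 4, 5: "By (i)' and (ii) of axiom 4 applied to
the pair `(X₂, 𝓘)`, there exists a projective birational morphism `π : Z₁ → X₂` such that `𝓘𝒪_{Z₁}`
is locally principal … and `π⁻¹(Reg X₂) ⊆ Reg Z₁`") and in Cossart–Piltant's own Step 2 ("we may
replace `𝒰'₁` by any blow up along a regular center contained in `𝓕̄₁`", the Zariski closure) —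
the sequence of blowing ups `U' → U` has to be EXTENDED to a projective birational `X' → X` whose
restriction over `U` it is. The classical device is to blow up, at each stage, the Zariski
closure of the centre. This file PROVES that it works, in the blowing-up vocabulary of the tree
(`IsBlowup`, `blowup`, `IsRegularCentreBlowupSeq`):

* `preimage_closure_image_eq` — for an open immersion `j : S → X` and a closed `Y ⊆ S`,
  `j⁻¹(closure (j Y)) = Y`; `comap_vanishingIdeal_closure_image` — the ideal of the reduced
  closed subscheme on `closure (j Y)` restricts to that of `Y`;
* **`IsRegularCentreBlowupSeq.exists_extension`** — for a Cossart–Piltant sequence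
  `σ : S' → S` for `J ≠ 0` on an integral locally Noetherian `S`, and an open immersion
  `j : S → X` into an integral locally Noetherian `X`, there are `ρ : X' → X` and an open
  immersion `j' : S' → X'` with `X' ×_X S = S'` (`IsPullback j' σ ρ j`), `ρ` proper and
  birational, `X'` integral, and `X'` projective over any field over which `X` is (each step is
  the blowing up of `X'` along the reduced closure of the centre, whose restriction to `S'` is
  the given blowing up: blowing ups commute with open immersions, `IsBlowup.isPullback_of_isOpenImmersion`;
  blowing ups of projective schemes are projective, `IsBlowup.isProjectiveOver`);
* `IsRegularCentreBlowupSeq.exists_extension_regular` — the same, recording that `X'` is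
  regular over `j(S)` when `S` is regular (`IsRegularCentreBlowupSeq.isRegular`) and that
  `J𝒪_{S'}` is read off `X'` over `j'`.

## References

* O. Piltant, *An axiomatic version of Zariski's patching theorem*, RACSAM 107 (2013), §2
  Axiom 4, Prop. 5.1 Step 2. [Piltant2013]
* V. Cossart, O. Piltant, J. Algebra 529 (2019), proof of Prop. 4.6 (arXiv v1: Prop. 4.4),
  Step 2. [CossartPiltant2019]
* U. Görtz, T. Wedhorn, *Algebraic Geometry I*, 2nd ed. (2020), Prop. 13.91. [GortzWedhorn2020]
-/

noncomputable section

open CategoryTheory CategoryTheory.Limits AlgebraicGeometry TopologicalSpace Topology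

namespace Literature.AlgebraicGeometry.Resolution

universe u

open Scheme.IdealSheafData

/-! ## Closures of closed subsets of an open subscheme -/

section Closure

variable {S X : Scheme.{u}} (j : S ⟶ X)

/-- The Zariski closure in `X` of (the image of) a subset of `S` along `j : S → X`. [folklore] -/
def closureImage (Y : Set S) : Closeds X :=
  ⟨closure (j '' Y), isClosed_closure⟩

/-- Unfolding. [folklore] -/
@[simp] theorem coe_closureImage (Y : Set S) : (closureImage j Y : Set X) = closure (j '' Y) := rfl

variable [IsOpenImmersion j]

/-- **`j⁻¹(closure (j Y)) = Y`** for a closed subset `Y` of the open subscheme `S` (an open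
immersion is an embedding). [folklore] -/
theorem preimage_closureImage_eq (Y : Closeds S) :
    (closureImage j (Y : Set S)).preimage j.continuous = Y := by
  ext1
  rw [Closeds.coe_preimage, coe_closureImage,
    ← j.isOpenEmbedding.isInducing.closure_eq_preimage_closure_image, Y.isClosed.closure_eq]

/-- **The reduced closure restricts to the reduced centre**: the vanishing ideal sheaf of
`closure (j Y)` pulls back along `j` to the vanishing ideal sheaf of `Y`. [folklore] -/
theorem comap_vanishingIdeal_closureImage (Y : Closeds S) :
    (vanishingIdeal (closureImage j (Y : Set S))).comap j = vanishingIdeal Y := by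
  rw [comap_vanishingIdeal_of_isOpenImmersion, preimage_closureImage_eq]

/-- If `Y ≠ S` then the closure of `j Y` is not all of `X`, so its vanishing ideal sheaf is
non-zero. [folklore] -/
theorem vanishingIdeal_closureImage_ne_bot (Y : Closeds S) (hY : (Y : Set S) ≠ Set.univ) :
    vanishingIdeal (closureImage j (Y : Set S)) ≠ ⊥ := by
  intro h
  apply hY
  have hsupp : ((vanishingIdeal (closureImage j (Y : Set S))).support : Set X) = Set.univ := by
    rw [h, support_bot]; rfl
  rw [coe_support_vanishingIdeal] at hsupp
  have := congrArg (fun T : Closeds X => ((T.preimage j.continuous : Closeds S) : Set S))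
    (show closureImage j (Y : Set S) = ⊤ from Closeds.ext hsupp)
  simp only [preimage_closureImage_eq] at this
  rw [this, Closeds.coe_preimage, Closeds.coe_top, Set.preimage_univ]

end Closure

/-! ## The extension theorem -/

/-- The identity is birational. [folklore] -/
theorem isBirational_id (X : Scheme.{u}) : IsBirational (𝟙 X) :=
  ⟨⊤, by simp [dense_univ], by simp [dense_univ], inferInstance⟩

/-- **Extending a Cossart–Piltant sequence of blowing ups from an open subscheme.** Let
`σ : S' → S` be a finite composition of blowing ups along regular integral centres in the
non-locally-principal loci of the transforms of `J ≠ 0` (`IsRegularCentreBlowupSeq σ J`), `S`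
integral and locally Noetherian, and `j : S → X` an open immersion into an integral locally
Noetherian scheme. Then there are `ρ : X' → X` and an open immersion `j' : S' → X'` making
`S' = X' ×_X S` (a cartesian square `j' ≫ ρ = σ ≫ j`), with `ρ` proper and birational, `X'`
integral, and `X'` projective over every field over which `X` is projective. Construction: blow
up, step by step, the reduced Zariski closure of the centre (Piltant 2013, proof of Prop. 5.1,
Step 2; Cossart–Piltant 2019, proof of Prop. 4.6, Step 2: "we may replace `𝒰'₁` by any blow up
along a regular center contained in" the Zariski closure `𝓕̄₁`); its restriction over the open
is the given blowing up because blowing up commutes with open immersions (Görtz–Wedhorn I,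
Prop. 13.91 (2)). [cite: Piltant2013, Prop. 5.1 (proof, Step 2)] -/
theorem IsRegularCentreBlowupSeq.exists_extension :
    ∀ {S' S : Scheme.{u}} {σ : S' ⟶ S} {J : S.IdealSheafData}, IsRegularCentreBlowupSeq σ J →
      IsIntegral S → IsLocallyNoetherian S → J ≠ ⊥ →
      ∀ {X : Scheme.{u}} [IsIntegral X] [IsLocallyNoetherian X] (j : S ⟶ X) [IsOpenImmersion j],
        ∃ (X' : Scheme.{u}) (ρ : X' ⟶ X) (j' : S' ⟶ X'), IsOpenImmersion j' ∧
          IsPullback j' σ ρ j ∧ IsProper ρ ∧ IsIntegral X' ∧ IsBirational ρ ∧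
          ∀ (k : Type u) [Field k] (f : X ⟶ Spec (.of k)),
            Motives.IsProjectiveOver (Over.mk f) → Motives.IsProjectiveOver (Over.mk (ρ ≫ f)) := by
  intro S' S σ J h
  induction h with
  | nil J =>
    intro _ _ _ X _ _ j _
    refine ⟨X, 𝟙 X, j, inferInstance, IsPullback.of_vert_isIso ⟨by simp⟩, inferInstance,
      inferInstance, isBirational_id X, fun k _ f hf => by rwa [Category.id_comp]⟩
  | @cons S'' S' S τ σ J Y hσ hYint hYreg hY hτ ih =>
    intro hint hN hJ X _ _ j _
    obtain ⟨X', ρ, j', hj', hpb, hprop, hint', hbir, hproj⟩ := ih hint hN hJ j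
    haveI := hj'
    haveI := hint'
    haveI := hprop
    haveI : IsLocallyNoetherian X' := LocallyOfFiniteType.isLocallyNoetherian ρ
    obtain ⟨hintS', hNS', hJ'⟩ := hσ.isIntegral_and_comap_ne_bot hint hN hJ
    haveI := hintS'
    haveI := hNS'
    -- the centre is a proper closed subset of `S'`
    have hYne : (Y : Set S') ≠ Set.univ := by
      intro hYu
      apply nonPrincipalLocus_ne_top hJ'
      rw [eq_top_iff]
      intro y _
      exact hY y (by rw [hYu]; trivial)
    -- blow up `X'` along the reduced closure of `j'(Y)`
    let C : X'.IdealSheafData := vanishingIdeal (closureImage j' (Y : Set S'))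
    have hC : C.comap j' = vanishingIdeal Y := comap_vanishingIdeal_closureImage j' Y
    have hC0 : C ≠ ⊥ := vanishingIdeal_closureImage_ne_bot j' Y hYne
    have hτ' : IsBlowup τ (C.comap j') := by rw [hC]; exact hτ
    let j'' : S'' ⟶ blowup C := (blowup.isBlowup C).lift (τ ≫ j')
      (by rw [Scheme.IdealSheafData.comap_comp]; exact hτ'.isEffectiveCartier)
    have hj''π : j'' ≫ blowup.π C = τ ≫ j' := (blowup.isBlowup C).lift_comp _ _
    have hsq : IsPullback j'' τ (blowup.π C) j' :=
      (blowup.isBlowup C).isPullback_of_isOpenImmersion j' hτ' hj''π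
    haveI : IsOpenImmersion j'' := MorphismProperty.of_isPullback hsq.flip inferInstance
    haveI : IsProper (blowup.π C) := (blowup.isBlowup C).isProper
    refine ⟨blowup C, blowup.π C ≫ ρ, j'', inferInstance, hsq.paste_vert hpb, inferInstance,
      (blowup.isBlowup C).isIntegral hC0, ((blowup.isBlowup C).isBirational' hC0).comp hbir,
      fun k _ f hf => ?_⟩
    rw [Category.assoc]
    exact (blowup.isBlowup C).isProjectiveOver (ρ ≫ f) (hproj k f hf)

/-- **The extension is regular over the open and principalizes there.** In the situation of
`IsRegularCentreBlowupSeq.exists_extension` with `S` regular and `J𝒪_{S'}` locally principal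
(the output of `CossartPiltant2019Principalization` on `S`): every point of `X'` over `j(S)` is
of the form `j' s'` with `𝒪_{X', j' s'} ≅ 𝒪_{S', s'}` regular (Piltant's Axiom 4 (ii):
"`π⁻¹(Reg_P X) ⊆ Reg_P(X')`" for `P` = regularity, on the open `Reg X`).
[cite: Piltant2013, §2 Axiom 4 (ii)] -/
theorem IsRegularCentreBlowupSeq.exists_extension_regular {S' S : Scheme.{u}} {σ : S' ⟶ S}
    {J : S.IdealSheafData} (h : IsRegularCentreBlowupSeq σ J) [IsIntegral S]
    [IsLocallyNoetherian S] (hreg : Scheme.IsRegular S) (hJ : J ≠ ⊥) {X : Scheme.{u}}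
    [IsIntegral X] [IsLocallyNoetherian X] (j : S ⟶ X) [IsOpenImmersion j] :
    ∃ (X' : Scheme.{u}) (ρ : X' ⟶ X) (j' : S' ⟶ X'), IsOpenImmersion j' ∧
      IsPullback j' σ ρ j ∧ IsProper ρ ∧ IsIntegral X' ∧ IsBirational ρ ∧
      (∀ (k : Type u) [Field k] (f : X ⟶ Spec (.of k)),
        Motives.IsProjectiveOver (Over.mk f) → Motives.IsProjectiveOver (Over.mk (ρ ≫ f))) ∧
      Scheme.IsRegular S' ∧
      ∀ x' : X', ρ x' ∈ Set.range j → ∃ s' : S', j' s' = x' := by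
  obtain ⟨X', ρ, j', hj', hpb, hprop, hint', hbir, hproj⟩ :=
    h.exists_extension inferInstance inferInstance hJ j
  refine ⟨X', ρ, j', hj', hpb, hprop, hint', hbir, hproj, h.isRegular hreg, ?_⟩
  rintro x' ⟨s, hs⟩
  -- points of the fibre product
  obtain ⟨s', hs'₁, -⟩ := Scheme.Pullback.exists_preimage_pullback x' s hs.symm
  refine ⟨(hpb.isoPullback).inv s', ?_⟩
  rw [← hs'₁, ← Scheme.Hom.comp_apply, IsPullback.isoPullback_inv_fst]

end Literature.AlgebraicGeometry.Resolution

end
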